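import Literature.NumberTheory.Automorphic.ReductiveDualRankOne
import Literature.NumberTheory.Automorphic.ReductiveDualGLn
import Literature.NumberTheory.Automorphic.RankOneRealization
import Literature.NumberTheory.Automorphic.RankOneAlgebraic
import HarnessLib

/-!
# Root data of reductive groups: reduction of the `SL₂`-realisations to Springer's relations (19), (20)
(trunk T-AUTOMORPHIC, G25 AutomorphicL; lang.S13 (b))

The named fact `exists_sl2Realization_of_central` (`ReductiveDualRankOne.lean`: in the group
`G_α = Z_G((Ker α)°)`, of semisimple rank one, the root `α` is realised by a homomorphism
`SL₂ → G_α`, Springer 8.1.4 (i)) is reduced here to the purely structure-theoretic content of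
Springer 7.2.4 (first page of the proof) and 7.3.2–7.3.4: the existence in `G_α` of a root
homomorphism `u = u_α`, a cocharacter `t = λ : 𝔾ₘ → T₁ ≤ T` and a Weyl element `n` satisfying
the multiplication rules

  (19) `n u(y) n⁻¹ = u(-y⁻¹) n t(y^{m'}) u(-y⁻¹)` (`y ≠ 0`), `n² = t((-1)^{m'})`,
  (20) `t(z) u(x) t(z)⁻¹ = u(z^m x)`, with `m m' = 2` and `n t(z) n⁻¹ = t(z⁻¹)`,

vendored as the named fact `exists_rankOneRelations_of_central`. Everything downstream is proved
in the tree: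

* `RankOneRelations.lift` (`RankOneRelations.lean`): (19), (20) define a homomorphism
  `φ : SL₂(k) → G` with `φ ∘ u₁ = u`, `φ(n₁) = n`, `φ(t₁(y)) = t(y^{m'})` (7.2.4);
* `RankOneRelations.isAlgebraicSL2Hom_lift` (`RankOneAlgebraic.lean`): `φ` is a homomorphism of
  algebraic groups (7.2.4: regular on the big cell and its translate, glued over `k[SL₂]`);
* `RankOneRelations.isSL2Realization` (`RankOneRealization.lean`): `φ` realises `(α, α^∨)` with
  `α^∨ = m' λ` (7.3.5 (i), 8.1.4 (i));

and two consistency checks of the vendored relations are proved here: `rankOneRelations_SL2`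
((19), (20) hold in `SL₂` with `m = 2`, `m' = 1`, Springer p. 132) and
`exists_rankOneRelations_generalLinearGroup` (the full conclusion of the named fact — `u`, `t`,
`n`, `σ`, `m`, `m'` — holds for every root `α_{ij}` of `(GL n, 𝔻ₙ)`: push the `SL₂` relations
forward along the block embedding, `RankOneRelations.map`, and compute that the block Weyl
element swaps the diagonal entries `i, j`, `sl2BlockGL_weylSL2_conj_diagonalGL`);

so that `exists_sl2Realization_of_central_of_relations` and the assembly
`Literature.NumberTheory.Automorphic.exists_isRootDatumOf_of_relations` (**proved**) leave, for lang.S13 (b)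
(`Literature.NumberTheory.Automorphic.exists_isRootDatumOf`, Springer 7.4.3), exactly the four structure-theoretic inputs
7.6.4 (i) (`isConnectedReductive_centralizer_torus`), 7.1.4 + 6.4.12
(`atMostTwo_isBorelIn_of_central`), 7.3.2–7.3.3 (`exists_rootHom_sup_isBorelIn_of_central`) and
7.2.4 (19)–(20) (`exists_rankOneRelations_of_central`), all statements about Borel subgroups and
the Bruhat decomposition `G = B ∪ U n B` of groups of semisimple rank one (7.2.2), i.e. about the
completeness of `G/B`.

## Mathlib

Mathlib has no linear algebraic groups, Borel subgroups or Bruhat decompositions; `powMonoidHom`,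
`Subgroup.inclusion`, `Matrix.SpecialLinearGroup` (`coe_inv`, `adjugate_fin_two_of`),
`MulEquiv.arrowCongr` (permuting the entries of `𝔻ₙ ≅ (n → kˣ)`, `diagPermEquiv`) and
`Equiv.swap` are used. Nothing here duplicates a Mathlib or Literature declaration (searched
`Bruhat`, `rank one`, `IsAlgebraicCochar`, `Equiv.swap` + `diagonal`).

## References

* [SpringerLAG1998] T. A. Springer, *Linear Algebraic Groups*, 2nd ed., Progress in Mathematics 9,
  Birkhäuser (1998): 7.2.1–7.2.4 (formulas (19), (20)), 7.3.2–7.3.5, 7.4.3, 8.1.4 (i).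
-/

open scoped MatrixGroups
open Multiplicative (ofAdd)

namespace Literature.NumberTheory.Automorphic

variable {k : Type*} [Field k] {n : Type*} [Fintype n] [DecidableEq n]

/-- A cocharacter of `T ≤ G` is algebraic as a cocharacter of `G` (same coordinates). [folklore] -/
theorem IsAlgebraicCochar.inclusion_comp {G T : Subgroup (GL n k)} (hTG : T ≤ G) {γ : kˣ →* ↥T}
    (hγ : IsAlgebraicCochar γ) : IsAlgebraicCochar ((Subgroup.inclusion hTG).comp γ) := by
  obtain ⟨P, hP⟩ := hγ
  exact ⟨P, fun x c => by rw [MonoidHom.comp_apply, Subgroup.coe_inclusion, hP]⟩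

/-- **Named fact (Springer 7.2.4, formulas (19), (20), in the setting of 7.3.2–7.3.4).** Let `G` be
connected reductive over an algebraically closed field, `T` a maximal torus, `α` a root such that
the singular torus `S = (Ker α)°` is central in `G` (so that `G = G_α` is of semisimple rank one,
7.3.2, and `T = T₁ S` with `T₁` a maximal torus of `(G, G)`). Then there are a root homomorphism
`u = u_α : 𝔾ₐ → G` for `α` (7.3.3 (i)), a cocharacter `t = λ : 𝔾ₘ → T₁ ≤ T` (7.3.4), an element
`n ∈ N_{(G,G)}(T₁) ⊆ N_G(T)` representing the non-trivial element of the Weyl group — acting on `T`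
by an automorphism `σ` with `α ∘ σ = -α` (7.1.8, 7.3.4: `s_α`) — and integers `m, m'` with
`m m' = 2`, such that Springer's multiplication rules hold:
`t(z) u(x) t(z)⁻¹ = u(z^m x)` (20), `n t(z) n⁻¹ = t(z⁻¹)`, `n² = t((-1)^{m'})` and
`n u(y) n⁻¹ = u(-y⁻¹) n t(y^{m'}) u(-y⁻¹)` for `y ≠ 0` (19) (the structure `RankOneRelations`).
Springer obtains `n` and (19) from the Bruhat decomposition `G = B ∪ U n B` of 7.2.2 (i)
(completeness of `G/B ≅ 𝐏¹`) by normalising a Weyl element ("*by modifying `n` we may assume that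
`a = b = -1` … replacing `n` by `n t(η)`*"). Stated in the `k`-points vocabulary of this file's
imports; it is the remaining structure-theoretic input of `exists_sl2Realization_of_central`
(`exists_sl2Realization_of_central_of_relations`). [cite: SpringerLAG1998, 7.2.4 (proof, (19)–(20)) with 7.2.2 (i), 7.3.2–7.3.4] -/
def exists_rankOneRelations_of_central : Prop :=
  ∀ [IsAlgClosed k] {G T : Subgroup (GL n k)}, IsConnectedReductive G →
    ∀ hT : IsMaximalTorusIn T G, ∀ [IsMulCommutative ↥T], ∀ {α : ↥(characterLattice T)},
    α ∈ roots G T →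
    G ≤ Subgroup.centralizer
      ((identityComponent ((α : ↥T →* kˣ).ker.map T.subtype) : Subgroup (GL n k)) :
        Set (GL n k)) →
    ∃ (u : Multiplicative k →* ↥G) (tT : ↥(cocharacterLattice T)) (nn : ↥G) (σ : ↥T ≃* ↥T)
      (m m' : ℕ), IsRootHom G T hT.1 (α : ↥T →* kˣ) u ∧
      (∀ s : ↥T, nn⁻¹ * Subgroup.inclusion hT.1 s * nn = Subgroup.inclusion hT.1 (σ s)) ∧
      (α : ↥T →* kˣ).comp σ.toMonoidHom = (α : ↥T →* kˣ)⁻¹ ∧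
      RankOneRelations u ((Subgroup.inclusion hT.1).comp (tT : kˣ →* ↥T)) nn m m'

/-- **The relations (19), (20) hold in `SL₂` itself, with `m = 2`, `m' = 1`** (Springer 7.2.4:
"*For `t₁`, `u₁` and `n₁` we have the multiplication rules of (19) and (20) with `m = 2`*"): a
consistency check of `RankOneRelations` against the tree's `unipotentUpperSL2`, `diagSL2`,
`weylSL2`. [cite: SpringerLAG1998, 7.2.4 (proof)] -/
theorem rankOneRelations_SL2 :
    RankOneRelations (unipotentUpperSL2 : Multiplicative k →* SL(2, k)) diagSL2 weylSL2 2 1 where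
  mul_eq := rfl
  conj_u z x := by
    rw [mul_inv_eq_iff_eq_mul]
    refine Subtype.ext ?_
    change (diagSL2 z : SL(2, k)).1 * (unipotentUpperSL2 (ofAdd x) : SL(2, k)).1 =
      (unipotentUpperSL2 (ofAdd ((z : k) ^ 2 * x)) : SL(2, k)).1 * (diagSL2 z : SL(2, k)).1
    have hz : (z : k) ≠ 0 := z.ne_zero
    simp only [coe_diagSL2, coe_unipotentUpperSL2, toAdd_ofAdd, Matrix.mul_fin_two,
      Units.val_inv_eq_inv_val]
    refine Matrix.ext fun i j => ?_
    fin_cases i <;> fin_cases j <;> simp [sq, mul_assoc, mul_left_comm (z : k), hz]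
  conj_t z := by
    rw [mul_inv_eq_iff_eq_mul]
    refine Subtype.ext ?_
    change (weylSL2 : SL(2, k)).1 * (diagSL2 z : SL(2, k)).1 =
      (diagSL2 z⁻¹ : SL(2, k)).1 * (weylSL2 : SL(2, k)).1
    simp only [coe_diagSL2, coe_weylSL2, inv_inv, Matrix.mul_fin_two]
    refine Matrix.ext fun i j => ?_
    fin_cases i <;> fin_cases j <;> simp
  sq := by
    rw [pow_one]
    exact weylSL2_mul_weylSL2
  conj_n y := by
    rw [mul_inv_eq_iff_eq_mul, pow_one]
    refine Subtype.ext ?_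
    change (weylSL2 : SL(2, k)).1 * (unipotentUpperSL2 (ofAdd (y : k)) : SL(2, k)).1 =
      (unipotentUpperSL2 (ofAdd (-((y⁻¹ : kˣ) : k))) : SL(2, k)).1 * (weylSL2 : SL(2, k)).1 *
        (diagSL2 y : SL(2, k)).1 * (unipotentUpperSL2 (ofAdd (-((y⁻¹ : kˣ) : k))) : SL(2, k)).1 *
        (weylSL2 : SL(2, k)).1
    have hy : (y : k) ≠ 0 := y.ne_zero
    simp only [coe_diagSL2, coe_weylSL2, coe_unipotentUpperSL2, toAdd_ofAdd, Matrix.mul_fin_two,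
      Units.val_inv_eq_inv_val]
    refine Matrix.ext fun i j => ?_
    fin_cases i <;> fin_cases j <;> simp [hy]

/-- Relations (19), (20) push forward along homomorphisms. [folklore] -/
theorem RankOneRelations.map {G H : Type*} [Group G] [Group H] {u : Multiplicative k →* G}
    {t : kˣ →* G} {nn : G} {m m' : ℕ} (h : RankOneRelations u t nn m m') (f : G →* H) :
    RankOneRelations (f.comp u) (f.comp t) (f nn) m m' where
  mul_eq := h.mul_eq
  conj_u z x := by
    simpa only [MonoidHom.comp_apply, map_mul, map_inv] using congrArg f (h.conj_u z x)
  conj_t z := by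
    simpa only [MonoidHom.comp_apply, map_mul, map_inv] using congrArg f (h.conj_t z)
  sq := by simpa only [MonoidHom.comp_apply, map_mul] using congrArg f h.sq
  conj_n y := by
    simpa only [MonoidHom.comp_apply, map_mul, map_inv] using congrArg f (h.conj_n y)

section GLnModel

attribute [local instance] isMulCommutative_diagonalSubgroup

/-- A block-embedded `2 × 2` matrix commutes with the diagonal matrices that are `1` on the
block. [folklore] -/
lemma blockMatHom_mul_diagonal_comm {i j : n} (hij : i ≠ j) (A : Matrix (Fin 2) (Fin 2) k)
    (f : n → k) (hi : f i = 1) (hj : f j = 1) :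
    blockMatHom hij A * Matrix.diagonal f = Matrix.diagonal f * blockMatHom hij A := by
  ext p q
  rw [Matrix.mul_diagonal, Matrix.diagonal_mul]
  by_cases hpq : p = q
  · subst hpq
    exact mul_comm _ _
  · rw [blockMatHom_apply_apply]
    have h1 : ¬(i = p ∧ i = q) := fun h => hpq (h.1.symm.trans h.2)
    have h2 : ¬(j = p ∧ j = q) := fun h => hpq (h.1.symm.trans h.2)
    simp only [if_neg hpq, if_neg h1, if_neg h2, zero_add, add_zero]
    by_cases hij' : i = p ∧ j = q
    · obtain ⟨rfl, rfl⟩ := hij'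
      have h3 : ¬(j = i ∧ i = j) := fun h => hij h.2
      simp [h3, hi, hj]
    · by_cases hji' : j = p ∧ i = q
      · obtain ⟨rfl, rfl⟩ := hji'
        simp [hij', hi, hj]
      · simp [hij', hji']

/-- A diagonal matrix factors as its `{i, j}`-block times a diagonal matrix trivial on the block.
[folklore] -/
lemma diagonal_eq_blockMatHom_mul {i j : n} (hij : i ≠ j) (f : n → k) :
    Matrix.diagonal f = blockMatHom hij (Matrix.diagonal ![f i, f j]) *
      Matrix.diagonal (fun p => if p = i ∨ p = j then 1 else f p) := by
  rw [blockMatHom_diagonal, Matrix.diagonal_mul_diagonal]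
  congr 1
  funext p
  by_cases hpi : p = i
  · subst hpi
    simp
  · by_cases hpj : p = j
    · subst hpj
      simp [hpi]
    · simp [hpi, hpj]

/-- `n₁⁻¹ diag(a, b) n₁ = diag(b, a)` in `SL₂`. [folklore] -/
lemma weylInv_mul_diagonal_mul_weyl (a b : k) :
    !![(0 : k), -1; 1, 0] * Matrix.diagonal ![a, b] * !![0, 1; -1, 0] = Matrix.diagonal ![b, a] := by
  rw [Matrix.eta_fin_two (Matrix.diagonal ![a, b]), Matrix.eta_fin_two (Matrix.diagonal ![b, a])]
  simp [Matrix.diagonal_apply_ne, Matrix.diagonal_apply_eq]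

/-- **Conjugating `𝔻ₙ` by the block Weyl element `n₁` at `(i, j)` swaps the entries `i, j`.**
[folklore] -/
theorem sl2BlockGL_weylSL2_conj_diagonalGL {i j : n} (hij : i ≠ j) (d : n → kˣ) :
    (sl2BlockGL hij weylSL2 : GL n k)⁻¹ * diagonalGL n k d * sl2BlockGL hij weylSL2 =
      diagonalGL n k (d ∘ Equiv.swap i j) := by
  apply Units.ext
  have hWinv : ((weylSL2⁻¹ : SL(2, k)) : Matrix (Fin 2) (Fin 2) k) = !![0, -1; 1, 0] := by
    rw [Matrix.SpecialLinearGroup.coe_inv, coe_weylSL2, Matrix.adjugate_fin_two_of]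
    simp
  rw [Units.val_mul, Units.val_mul, ← map_inv, coe_sl2BlockGL, coe_sl2BlockGL, hWinv, coe_weylSL2,
    coe_diagonalGL, coe_diagonalGL]
  set f : n → k := fun p => (d p : k) with hf
  have hf' : (fun p => ((d ∘ Equiv.swap i j) p : k)) = f ∘ Equiv.swap i j := rfl
  rw [hf', diagonal_eq_blockMatHom_mul hij f, diagonal_eq_blockMatHom_mul hij (f ∘ Equiv.swap i j)]
  have htriv : (fun p => if p = i ∨ p = j then (1 : k) else (f ∘ Equiv.swap i j) p) =
      fun p => if p = i ∨ p = j then (1 : k) else f p := by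
    funext p
    by_cases hp : p = i ∨ p = j
    · rw [if_pos hp, if_pos hp]
    · rw [if_neg hp, if_neg hp, Function.comp_apply,
        Equiv.swap_apply_of_ne_of_ne (fun h => hp (Or.inl h)) (fun h => hp (Or.inr h))]
  rw [htriv, ← mul_assoc, mul_assoc _ _ (blockMatHom hij _),
    ← blockMatHom_mul_diagonal_comm hij _ _ (by simp) (by simp [hij.symm]), ← mul_assoc, ← map_mul,
    ← map_mul, weylInv_mul_diagonal_mul_weyl]
  congr 3
  funext p
  fin_cases p
  · simp [Equiv.swap_apply_left]
  · simp [Equiv.swap_apply_right]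

/-- The automorphism of `𝔻ₙ` permuting the diagonal entries by `e`. [folklore] -/
noncomputable def diagPermEquiv (e : Equiv.Perm n) :
    ↥(diagonalSubgroup n k) ≃* ↥(diagonalSubgroup n k) :=
  ((diagonalSubgroupEquiv n k).symm.trans (MulEquiv.arrowCongr e (MulEquiv.refl kˣ))).trans
    (diagonalSubgroupEquiv n k)

/-- `diagPermEquiv e (diag d) = diag (d ∘ e⁻¹)`. [folklore] -/
lemma diagPermEquiv_diagElt (e : Equiv.Perm n) (d : n → kˣ) :
    diagPermEquiv e (diagElt d) = diagElt (k := k) (d ∘ e.symm) := by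
  have hd : diagElt (k := k) d = diagonalSubgroupEquiv n k d := rfl
  rw [diagPermEquiv, hd, MulEquiv.trans_apply, MulEquiv.trans_apply, MulEquiv.symm_apply_apply]
  rfl

/-- **The conclusion of `exists_rankOneRelations_of_central` holds for every root `α_{ij}` of
`(GL n, 𝔻ₙ)`**: `u = u_{ij}`, `t = α_{ij}^∨`, `n` = the block Weyl element `n₁` at `(i, j)`,
`σ` = the transposition of the entries `i, j`, `m = 2`, `m' = 1` (Springer 8.1.4 (i), proof,
p. 145: "*a straightforward check shows that, with the notations of the proof of 7.2.4, we may
take*" the standard `u, t, n` of `SL₂`; pushed forward along the block embedding). A consistency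
check of the named fact. [cite: SpringerLAG1998, 7.2.4 (proof) and 7.4.7 (1)] -/
theorem exists_rankOneRelations_generalLinearGroup {i j : n} (hij : i ≠ j) :
    ∃ (u : Multiplicative k →* ↥(⊤ : Subgroup (GL n k)))
      (tT : ↥(cocharacterLattice (diagonalSubgroup n k))) (nn : ↥(⊤ : Subgroup (GL n k)))
      (σ : ↥(diagonalSubgroup n k) ≃* ↥(diagonalSubgroup n k)) (m m' : ℕ),
      IsRootHom ⊤ (diagonalSubgroup n k) le_top
        ((glRootChar i j : ↥(characterLattice (diagonalSubgroup n k))) :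
          ↥(diagonalSubgroup n k) →* kˣ) u ∧
      (∀ s : ↥(diagonalSubgroup n k),
        nn⁻¹ * Subgroup.inclusion le_top s * nn = Subgroup.inclusion le_top (σ s)) ∧
      ((glRootChar i j : ↥(characterLattice (diagonalSubgroup n k))) :
          ↥(diagonalSubgroup n k) →* kˣ).comp σ.toMonoidHom =
        ((glRootChar i j : ↥(characterLattice (diagonalSubgroup n k))) :
          ↥(diagonalSubgroup n k) →* kˣ)⁻¹ ∧
      RankOneRelations u ((Subgroup.inclusion le_top).comp
        ((tT : ↥(cocharacterLattice (diagonalSubgroup n k))) : kˣ →* ↥(diagonalSubgroup n k)))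
        nn m m' := by
  refine ⟨glRootHom i j hij, glCoroot i j, sl2BlockHom hij weylSL2, diagPermEquiv (Equiv.swap i j),
    2, 1, isRootHom_glRootHom i j hij, fun s => ?_, ?_, ?_⟩
  · obtain ⟨d, rfl⟩ := exists_diagElt_eq s
    apply Subtype.ext
    rw [diagPermEquiv_diagElt, Equiv.symm_swap]
    exact sl2BlockGL_weylSL2_conj_diagonalGL hij d
  · refine MonoidHom.ext fun s => ?_
    obtain ⟨d, rfl⟩ := exists_diagElt_eq s
    rw [MonoidHom.comp_apply, MulEquiv.coe_toMonoidHom, diagPermEquiv_diagElt, Equiv.symm_swap,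
      inv_coe_glRootChar, glRootChar_diagElt, glRootChar_diagElt, Function.comp_apply,
      Function.comp_apply, Equiv.swap_apply_left, Equiv.swap_apply_right]
  · have h := (rankOneRelations_SL2 (k := k)).map (sl2BlockHom (k := k) hij)
    have ht : (sl2BlockHom (k := k) hij).comp diagSL2 = (Subgroup.inclusion le_top).comp
        ((glCoroot i j : ↥(cocharacterLattice (diagonalSubgroup n k))) :
          kˣ →* ↥(diagonalSubgroup n k)) :=
      MonoidHom.ext fun y => sl2BlockHom_diagSL2 hij y
    rwa [sl2BlockHom_comp_unipotentUpperSL2, ht] at h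

end GLnModel

variable {G T : Subgroup (GL n k)}

/-- **`exists_sl2Realization_of_central` from the relations (19), (20)** (Springer 8.1.4 (i) with
7.2.4, 7.3.5 (i)): given `u, t, n, m, m'` as in `exists_rankOneRelations_of_central`, the
homomorphism `φ = RankOneRelations.lift : SL₂(k) → G` is algebraic
(`RankOneRelations.isAlgebraicSL2Hom_lift`) and realises `α` with coroot `α^∨(y) = t(y^{m'})`
(`RankOneRelations.isSL2Realization`). [cite: SpringerLAG1998, 8.1.4 (i) (proof) with 7.2.4, 7.3.5 (i)] -/
theorem exists_sl2Realization_of_central_of_relations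
    (hD : exists_rankOneRelations_of_central (k := k) (n := n)) :
    exists_sl2Realization_of_central (k := k) (n := n) := by
  intro _ G T hG hT _ α hα hcent
  obtain ⟨u, tT, nn, σ, m, m', hu, hn, hασ, h⟩ := hD hG hT hα hcent
  exact ⟨⟨(tT : kˣ →* ↥T).comp (powMonoidHom m'), tT.2.comp_powMonoidHom m'⟩, h.lift,
    h.isSL2Realization hu hn hασ
      (h.isAlgebraicSL2Hom_lift hu.1 (IsAlgebraicCochar.inclusion_comp hT.1 tT.2))⟩

end Literature.NumberTheory.Automorphic

/-! ## Assembly -/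

namespace Literature.NumberTheory.Automorphic


variable {k : Type*} [Field k] {n : Type*} [Fintype n] [DecidableEq n] {G T : Subgroup (GL n k)}

/-- **lang.S13 (b) from the structure theory of Borel subgroups** (Springer 7.4.3 with 8.1.1–8.1.4):
a connected reductive `G` with maximal torus `T` over an algebraically closed field carries a
reduced root datum on `(X^*(T), X_*(T))` with roots `R(G, T)` and the canonical pairing, granted
the four structure-theoretic named facts 7.6.4 (i) (`isConnectedReductive_centralizer_torus`),
7.1.4 + 6.4.12 (`atMostTwo_isBorelIn_of_central`), 7.3.2–7.3.3
(`exists_rootHom_sup_isBorelIn_of_central`) and 7.2.4 (19)–(20)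
(`exists_rankOneRelations_of_central`); the passage from these to the root datum — the
homomorphisms `SL₂ → G_α` (7.2.4), their algebraicity, the coroots and Weyl elements (7.3.5,
8.1.4), (RD 1), (RD 2), finiteness and reducedness of `R` (7.4.3–7.4.4) — is proved in the tree.
[cite: SpringerLAG1998, 7.4.3–7.4.4 with 7.6.4 (i), 7.1.4, 7.2.4, 7.3.2–7.3.5, 8.1.4 (i)] -/
theorem exists_isRootDatumOf_of_relations
    (hA : isConnectedReductive_centralizer_torus (k := k) (n := n))
    (hC₁ : atMostTwo_isBorelIn_of_central (k := k) (n := n))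
    (hC₂ : exists_rootHom_sup_isBorelIn_of_central (k := k) (n := n))
    (hD : exists_rankOneRelations_of_central (k := k) (n := n)) :
    exists_isRootDatumOf (G := G) (T := T) :=
  exists_isRootDatumOf_of_rankOne hA hC₁ hC₂ (exists_sl2Realization_of_central_of_relations hD)

end Literature.NumberTheory.Automorphic
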